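import Literature.Analysis.FluidPDE.MixedNormHolder
import Literature.Analysis.FluidPDE.HeatPotentialHolder
import HarnessLib

/-!
# Heat potentials of `L_{s,n}` data on a cylinder are parabolic-Hölder continuous

Analysis/FluidPDE support file (everything proved) on the decomposition path of the named fact
`Literature.Analysis.FluidPDE.ParabolicSobolevHolderEmbedding` (Seregin 2014, §4.6, Prop. 6.8:
`W^{2,1}_{s,n}(Q) ⊂ C^μ(Q̄(1/2))`, `μ = 2 - 2/n - 3/s`). The embedding is proved in the tree by
representing the localised function as the forward heat potential
`V(z) = ∫ W₊(z - w) F(w) dw` of `F = (∂ₜ - Δ)(φv) ∈ L_{s,n}(Q(z₀,R))`; this file supplies the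
real-variable half:

* `integrableOn_parabolicCylinder_of_mixedNorm_lt_top` — `L_{s,n}(Q(z,R)) ⊂ L¹(Q(z,R))` for a.e.
  strongly measurable functions (`1 < s`, `1 < n`; the quantitative bound of `MixedNormHolder`
  applied to a measurable representative);
* `exists_parabolicHolderOnWith_heatPotential_of_mixedNorm` — **for `1 < s`, `1 < n` with
  `0 < μ = 2 - 2/n - 3/s < 1` there is `κ = κ(s,n) ≥ 0` such that for every measurable real `F`
  vanishing off a cylinder `Q(z,R)` with `‖F‖_{s,n,Q(z,R)} < ∞`, the heat potential
  `z' ↦ ∫ W₊(z' - w) F(w) dw` (`W₊ = heatKernelFwd 1`) is Hölderian of exponent `μ` for the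
  parabolic distance on all of `ℝ × ℝ³`, with constant `κ ‖F‖_{s,n,Q(z,R)}`**: the data are
  `L¹`-Morrey with `∫∫_{Q*_ρ} |F| ≤ C₀ ‖F‖_{s,n} ρ^{3+μ}`
  (`exists_lintegral_parabolicCylinderCentered_le_mixedNorm`), and the tree's abstract theorem
  `parabolicHolderOnWith_integral_of_kernel_bounds` (`ParabolicSingularPotentials.lean`, `m = 3`,
  `d = 3 + μ ∈ (3,4)`) applies with the kernel bounds `|W₊|ρ₂³ ≤ G₃`,
  `|W₊(z) - W₊(z - z')|ρ₂(z)⁴ ≤ Aρ₂(z')` and the absolute convergence of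
  `HeatKernelParabolicBounds.lean` (exactly as in
  `HeatPotentialHolder.heatPotential_holder_of_morrey`);
* `ParabolicHolderOnWith.continuous_univ` — parabolic Hölder continuity on `ℝ × ℝ³` with positive
  exponent implies continuity.

## References

* G. Seregin, *Lecture notes on regularity theory for the Navier–Stokes equations*, World
  Scientific (2014), §4.6 Prop. 6.8. [`Seregin2014`]
* P. G. Lemarié-Rieusset, *The Navier–Stokes Problem in the 21st Century* (2016), Prop. 13.4
  pp. 464–465. [`LemarieRieusset2016`]
-/

noncomputable section

open MeasureTheory Set Function Filter TopologicalSpace Metric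
open scoped Topology ENNReal NNReal

namespace Literature.Analysis.FluidPDE

/-! ### Parabolic Hölder continuity implies continuity -/

/-- A function Hölderian of positive exponent for the parabolic distance on all of `ℝ × ℝ³` is
continuous. [folklore] -/
theorem ParabolicHolderOnWith.continuous_univ {F : Type*} [NormedAddCommGroup F] {C α : ℝ}
    {h : ℝ × EuclideanSpace ℝ (Fin 3) → F} (hh : ParabolicHolderOnWith C α h univ) (hα : 0 < α) :
    Continuous h := by
  refine continuous_iff_continuousAt.2 fun z₀ => ?_
  rw [ContinuousAt, tendsto_iff_norm_sub_tendsto_zero]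
  have hd : Tendsto (fun z => C * parabolicDist z z₀ ^ α) (𝓝 z₀) (𝓝 0) := by
    have hc : Continuous fun z : ℝ × EuclideanSpace ℝ (Fin 3) => C * parabolicDist z z₀ ^ α :=
      continuous_const.mul ((continuous_parabolicDist.comp
        (continuous_id.prodMk continuous_const)).rpow_const fun _ => Or.inr hα.le)
    have h1 := hc.tendsto z₀
    rwa [parabolicDist_self, Real.zero_rpow hα.ne', mul_zero] at h1
  refine squeeze_zero (fun z => norm_nonneg _) (fun z => ?_) hd
  exact hh z (mem_univ _) z₀ (mem_univ _)

/-! ### `L_{s,n}(Q) ⊂ L¹(Q)` -/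

/-- **`L_{s,n}(Q(z,R)) ⊂ L¹(Q(z,R))`**: an a.e. strongly measurable function on the cylinder with
finite mixed norm (`1 < s`, `1 < n`) is integrable on the cylinder (Hölder's inequality,
`lintegral_parabolicCylinder_le_mixedNorm`, applied to a measurable representative). [folklore] -/
theorem integrableOn_parabolicCylinder_of_mixedNorm_lt_top {β : Type*} [NormedAddCommGroup β]
    {s n : ℝ} (hs : 1 < s) (hn : 1 < n) (z : ℝ × EuclideanSpace ℝ (Fin 3)) {R : ℝ} (hR : 0 < R)
    {F : ℝ × EuclideanSpace ℝ (Fin 3) → β}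
    (hF : AEStronglyMeasurable F (volume.restrict (parabolicCylinder R z)))
    (h : mixedNorm s n z R F < ∞) : IntegrableOn F (parabolicCylinder R z) volume := by
  obtain ⟨C₀, -, hC₀⟩ := exists_lintegral_parabolicCylinderCentered_le_mixedNorm hs hn
  have hQ : MeasurableSet (parabolicCylinder R z) := (isOpen_parabolicCylinder R z).measurableSet
  -- a measurable representative of `‖F‖ₑ`, extended by zero
  set F' := hF.mk F with hF'
  set Φ : ℝ × EuclideanSpace ℝ (Fin 3) → ℝ≥0∞ :=
    (parabolicCylinder R z).indicator fun w => ‖F' w‖ₑ with hΦ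
  have hΦm : Measurable Φ := by
    refine Measurable.indicator ?_ hQ
    have h1 : Measurable fun w => ‖F' w‖ := hF.stronglyMeasurable_mk.norm.measurable
    simpa only [ofReal_norm] using h1.ennreal_ofReal
  have hΦ0 : ∀ w ∉ parabolicCylinder R z, Φ w = 0 := fun w hw => indicator_of_notMem hw _
  have hae : ∀ᵐ w ∂(volume.restrict (parabolicCylinder R z)), ‖F w‖ₑ = Φ w := by
    filter_upwards [hF.ae_eq_mk, ae_restrict_mem hQ] with w hw hwQ
    rw [hΦ, indicator_of_mem hwQ, hw]
  have hle : mixedNorm s n z R Φ ≤ mixedNorm s n z R F :=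
    mixedNorm_mono_ae (by linarith) (by linarith)
      (hae.mono fun w hw => by rw [enorm_eq_self, hw])
  refine ⟨hF, ?_⟩
  rw [HasFiniteIntegral, lintegral_congr_ae hae]
  calc ∫⁻ w in parabolicCylinder R z, Φ w
      ≤ mixedNorm s n z R Φ * ENNReal.ofReal (C₀ * R ^ (5 - 3 / s - 2 / n)) :=
        lintegral_parabolicCylinder_le_mixedNorm hC₀ z hR hΦm hΦ0
    _ < ∞ := ENNReal.mul_lt_top (lt_of_le_of_lt hle h) ENNReal.ofReal_lt_top

/-! ### Heat potentials of `L_{s,n}` data -/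

/-- **Heat potentials of `L_{s,n}` data are parabolic-Hölder of exponent `μ = 2 - 2/n - 3/s`.**
For `1 < s`, `1 < n` with `0 < μ < 1` there is `κ = κ(s,n) ≥ 0` such that for every measurable
`F : ℝ × ℝ³ → ℝ` vanishing off a cylinder `Q(z,R)` with `‖F‖_{s,n,Q(z,R)} < ∞`, the forward heat
potential `z' ↦ ∫ W₊(z' - w) F(w) dw`, `W₊ = heatKernelFwd 1`, satisfies
`|V(z₁) - V(z₂)| ≤ κ ‖F‖_{s,n,Q(z,R)} δ₂(z₁,z₂)^μ` for all `z₁, z₂` (`δ₂` the parabolic distance):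
`L_{s,n}` data are `L¹`-Morrey of order `d = 5 - 3/s - 2/n = 3 + μ ∈ (3, 4)`
(`exists_lintegral_parabolicCylinderCentered_le_mixedNorm`) and the abstract theorem
`parabolicHolderOnWith_integral_of_kernel_bounds` applies to the heat kernel (`m = 3`;
Lemarié-Rieusset 2016, Prop. 13.4, heat-kernel part; this is the kernel estimate behind
Seregin 2014, Prop. 6.8). [folklore] -/
theorem exists_parabolicHolderOnWith_heatPotential_of_mixedNorm {s n : ℝ} (hs : 1 < s)
    (hn : 1 < n) (hμ0 : 0 < 2 - 2 / n - 3 / s) (hμ1 : 2 - 2 / n - 3 / s < 1) :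
    ∃ κ : ℝ, 0 ≤ κ ∧ ∀ (z : ℝ × EuclideanSpace ℝ (Fin 3)) (R : ℝ)
      (F : ℝ × EuclideanSpace ℝ (Fin 3) → ℝ), Measurable F →
      (∀ w ∉ parabolicCylinder R z, F w = 0) → mixedNorm s n z R F < ∞ →
      ParabolicHolderOnWith (κ * (mixedNorm s n z R F).toReal) (2 - 2 / n - 3 / s)
        (fun z' => ∫ w, heatKernelFwd 1 (z' - w) * F w) univ := by
  obtain ⟨C₀, hC₀pos, hC₀⟩ := exists_lintegral_parabolicCylinderCentered_le_mixedNorm hs hn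
  set d : ℝ := 5 - 3 / s - 2 / n with hd
  have hd3 : 3 < d := by rw [hd]; linarith
  have hd4 : d < 3 + 1 := by rw [hd]; linarith
  have hdm : d - 3 = 2 - 2 / n - 3 / s := by rw [hd]; ring
  set A : ℝ := max (gaussConst 1 3) (heatRegConst 1) with hA
  have hA0 : 0 ≤ A := le_max_of_le_left (gaussConst_nonneg one_pos 3)
  -- `kernelHolderConst A B 3 d` is linear in `B`
  have hlin : ∀ B : ℝ, kernelHolderConst A B 3 d = kernelHolderConst A 1 3 d * B := fun B => by
    simp only [kernelHolderConst]; ring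
  have hκ0 : 0 ≤ kernelHolderConst A 1 3 d := by
    have h2dm : 1 < (2 : ℝ) ^ (d - 3) := Real.one_lt_rpow one_lt_two (by linarith)
    have h1 : 0 ≤ (1 - ((2 : ℝ) ^ (d - 3))⁻¹)⁻¹ := by
      rw [inv_nonneg, sub_nonneg]; exact inv_le_one_of_one_le₀ h2dm.le
    have h2 : 0 ≤ (1 - (2 : ℝ) ^ (d - 3 - 1))⁻¹ := by
      rw [inv_nonneg, sub_nonneg]
      exact Real.rpow_le_one_of_one_le_of_nonpos one_le_two (by linarith)
    simp only [kernelHolderConst]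
    positivity
  refine ⟨kernelHolderConst A 1 3 d * C₀, mul_nonneg hκ0 hC₀pos.le, fun z R F hFm hF0 hfin => ?_⟩
  -- the data and the kernel, as complex-valued functions
  set m : ℝ := (mixedNorm s n z R F).toReal with hm
  have hm0 : 0 ≤ m := ENNReal.toReal_nonneg
  have hmeq : mixedNorm s n z R F = ENNReal.ofReal m := by
    rw [hm, ENNReal.ofReal_toReal hfin.ne]
  set Fc : ℝ × EuclideanSpace ℝ (Fin 3) → ℂ := fun w => ((F w : ℝ) : ℂ) with hFc
  have hFcm : Measurable Fc := Complex.measurable_ofReal.comp hFm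
  have hFcn : ∀ w, ‖Fc w‖ₑ = ‖F w‖ₑ := fun w => by
    rw [hFc]; simp only; rw [← ofReal_norm, ← ofReal_norm, Complex.norm_real]
  set B : ℝ := C₀ * m with hB
  have hB0 : 0 ≤ B := mul_nonneg hC₀pos.le hm0
  have hMor : ∀ (c : ℝ × EuclideanSpace ℝ (Fin 3)) (ρ : ℝ), 0 < ρ →
      ∫⁻ w in parabolicCylinderCentered ρ c, ‖Fc w‖ₑ ≤ ENNReal.ofReal (B * ρ ^ d) := by
    intro c ρ hρ
    simp_rw [hFcn]
    have h1 := hC₀ z R (fun w => ‖F w‖ₑ) hFm.enorm (fun w hw => by simp [hF0 w hw]) c ρ hρ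
    rw [mixedNorm_enorm, hmeq, ← ENNReal.ofReal_mul hm0] at h1
    refine h1.trans (le_of_eq ?_)
    congr 1; rw [hB, hd]; ring
  have hFT : ∀ w : ℝ × EuclideanSpace ℝ (Fin 3), w.1 ≤ z.1 - R ^ 2 → Fc w = 0 := by
    intro w hw
    have : w ∉ parabolicCylinder R z := fun h' => by
      rw [mem_parabolicCylinder] at h'
      linarith [h'.1.1]
    simp [hFc, hF0 w this]
  set K : ℝ × EuclideanSpace ℝ (Fin 3) → ℂ := fun z => ((heatKernelFwd 1 z : ℝ) : ℂ) with hK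
  have hKm : Measurable K := Complex.measurable_ofReal.comp (measurable_heatKernelFwd 1)
  have hK0 : K 0 = 0 := by simp [hK, heatKernelFwd_zero]
  have hK1 : ∀ z, ‖K z‖ * parabolicNorm z ^ (3 : ℝ) ≤ A := fun z =>
    (heatKernelFwd_mul_parabolicNorm_pow_le one_pos z).trans (le_max_left _ _)
  have hK2 : ∀ z z' : ℝ × EuclideanSpace ℝ (Fin 3), 2 * parabolicNorm z' ≤ parabolicNorm z →
      ‖K z - K (z - z')‖ * parabolicNorm z ^ ((3 : ℝ) + 1) ≤ A * parabolicNorm z' := fun z z' h =>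
    (heatKernelFwd_sub_mul_parabolicNorm_pow_le one_pos z z' h).trans
      (mul_le_mul_of_nonneg_right (le_max_right _ _) (parabolicNorm_nonneg _))
  have hint : ∀ z, Integrable (fun w => K (z - w) * Fc w) := fun z =>
    integrable_heatKernelFwd_mul one_pos hFcm hB0 hd3 (by linarith) hFT hMor z
  have H := parabolicHolderOnWith_integral_of_kernel_bounds hKm hFcm hB0
    (by norm_num : (0 : ℝ) < 3) hd3 hd4 hK0 hK1 hK2 hMor hint
  -- back to the real potential
  have hre : (fun z' => (∫ w, K (z' - w) * Fc w).re) =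
      fun z' => ∫ w, heatKernelFwd 1 (z' - w) * F w := by
    funext z'
    have : (fun w => K (z' - w) * Fc w) =
        fun w => (((heatKernelFwd 1 (z' - w) * F w : ℝ)) : ℂ) := by
      funext w; simp [hK, hFc, Complex.ofReal_mul]
    rw [this, integral_complex_ofReal, Complex.ofReal_re]
  have H' := H.re
  rw [hre, hdm] at H'
  refine H'.mono_const (le_of_eq ?_)
  rw [hlin B, hB, hm]; ring

end Literature.Analysis.FluidPDE

end
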